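import Summits.QuantumFields.YangMills.Theorems.BalabanUVNodesN15KingModelExactCorrelationLength

/-!
# BalabanUVNodes ∕ N15 — THE KING-MODEL RUNG (PART Ϸ-n): THE SPECTRAL (KÄLLÉN–LEHMANN ∕ TRANSFER-MATRIX) REPRESENTATION ON THE AXES WITH MASS GAP `m`:
# `S₂^{ℝ}(te_ν) = ∫_{[m,∞)} e^{−λ(|t|−1)}dρ_ν(λ)` (`|t| ≥ 1`) for a FINITE positive Borel measure `ρ_ν` on `ℝ` with `ρ_ν((−∞,m)) = 0` (Track A, DAG node N15 = NE2;
# FAN-OUT v1.1 §N15 s3 «KING-MODEL RUNG»; the push-forward of part Ϸ-j's Laplace weight under `q ↦ M_q = √(|q|²+m²)`; count-neutral)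

HONEST FRAMING.  Count-neutral (cell `pub-ymgap`, seat `pub-ymgap-dag-n15-e` g34; `--supports stmt-QuantumFields-27366 --as helper` = K3⁸
`SpineGivenEndpointR13SepCoPHV`).  King's `A = 0`, `g = 0` model ([King1986] C. King, Commun. Math. Phys. **102** (1986) 649–677; `S₂^{ℝ}` = the infinite-volume
two-point function of the unit-block averages of the continuum free field of mass `m = √m²`, (4.5) p.670, (4.36) p.674).  Part Ϸ-j wrote, on the axis and for
`|t| ≥ 1`, `S₂^{ℝ}(te_ν) = (2π)^{−(d+1)}∫_{ℝ^d}W(q)e^{−M_q|t|}dq` with `W ≥ 0` continuous and `M_q = √(|q|²+m²) ≥ m`.  Pushing the finite measure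
`(2π)^{−(d+1)}W(q)e^{−M_q}dq` forward under `q ↦ M_q` gives a finite positive Borel measure `ρ_ν` on `ℝ`, carried by `[m,∞)`, with
`S₂^{ℝ}(te_ν) = ∫e^{−λ(|t|−1)}dρ_ν(λ)` for every integer `|t| ≥ 1` — a transfer-matrix ∕ Källén–Lehmann-type representation along the axis whose spectrum
starts at the mass `m` (one factor `e^{−λ}` is absorbed into `ρ_ν` because the bare spectral weight `W(q)dq` is not finite: `(cosh M − 1)M⁻³` grows).  Its total
mass is `ρ_ν(ℝ) = S₂^{ℝ}(e_ν) > 0`.  NOT a node discharge (N15 is booked through n15-a's knit, untouched here); nothing Bałaban ∕ continuum-Yang–Mills ∕ `ℝ⁴` ∕ OS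
reconstruction ∕ Clay — a statement about the FREE block field's axial two-point function.  0 `sorry`, 0 def (the measure is exhibited inside an `∃`); standard axioms.

WHAT THIS FILE PROVES (kernel).  `measurable_massShell` (`q ↦ M_q`), `sqrt_le_massShell`, `continuous_axisWeightOne`, `axisWeightOne_nonneg`, `integrable_axisWeightOne`,
`axisWeightOne_mul_exp`; ★★★ **`kingS2Inf_axis_spectral_representation`** (`∃ ρ` finite, `ρ(Iio √m²) = 0`, `S₂^{ℝ}(te_ν) = ∫e^{−λ(|t|−1)}dρ` for all `|t| ≥ 1`, and
`ρ(ℝ) = S₂^{ℝ}(e_ν)`).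

HONEST SCOPE.  King's free model, `K = ∞`, infinite volume, lattice axes, integer `|t| ≥ 1`.  N15 untouched; counts unmoved.  Locators (use): [King1986] (4.5) p.670,
(4.36) p.674, Thm 3.3 (3.6) p.655, Thm 2.1 (2.22)–(2.23) p.654.
-/

noncomputable section

open scoped BigOperators Topology ENNReal
open Filter MeasureTheory Set

namespace Summit.QuantumFields.YangMills.BalabanUVNodes.N15KingModelRung.OptimalDecay

variable {d : ℕ}

/-- The mass shell `q ↦ M_q = √(|q|²+m²)` is measurable. [folklore] -/
theorem measurable_massShell (m2 : ℝ) : Measurable fun q : Fin d → ℝ => Real.sqrt ((∑ j, q j ^ 2) + m2) :=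
  (by fun_prop : Continuous fun q : Fin d → ℝ => Real.sqrt ((∑ j, q j ^ 2) + m2)).measurable

/-- `M_q ≥ m = √m²`. [folklore] -/
theorem sqrt_le_massShell (m2 : ℝ) (q : Fin d → ℝ) : Real.sqrt m2 ≤ Real.sqrt ((∑ j, q j ^ 2) + m2) :=
  Real.sqrt_le_sqrt (le_add_of_nonneg_left (Finset.sum_nonneg fun _ _ => sq_nonneg _))

/-- The normalised axial weight at `t = 1`, `W₁(q) = (2π)^{−(d+1)}P(q)·2π(cosh M_q − 1)M_q⁻³e^{−M_q|1|}`, is continuous. [folklore] -/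
theorem continuous_axisWeightOne {m2 : ℝ} (hm : 0 < m2) :
    Continuous fun q : Fin d → ℝ => ((2 * Real.pi) ^ (d + 1))⁻¹ * ((∏ j, Real.sinc (q j / 2) ^ 2)
      * (2 * Real.pi * (Real.cosh (Real.sqrt ((∑ j, q j ^ 2) + m2)) - 1) / Real.sqrt ((∑ j, q j ^ 2) + m2) ^ 3
          * Real.exp (-(Real.sqrt ((∑ j, q j ^ 2) + m2) * |(1 : ℝ)|)))) :=
  continuous_const.mul (continuous_axisWeight hm 1)

/-- `W₁ ≥ 0`. [folklore] -/
theorem axisWeightOne_nonneg (m2 : ℝ) (q : Fin d → ℝ) :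
    0 ≤ ((2 * Real.pi) ^ (d + 1))⁻¹ * ((∏ j, Real.sinc (q j / 2) ^ 2)
      * (2 * Real.pi * (Real.cosh (Real.sqrt ((∑ j, q j ^ 2) + m2)) - 1) / Real.sqrt ((∑ j, q j ^ 2) + m2) ^ 3
          * Real.exp (-(Real.sqrt ((∑ j, q j ^ 2) + m2) * |(1 : ℝ)|)))) :=
  mul_nonneg (by positivity) (axisWeight_nonneg m2 1 q)

/-- `W₁` is integrable over `ℝ^d`. [folklore] -/
theorem integrable_axisWeightOne {m2 : ℝ} (hm : 0 < m2) :
    Integrable fun q : Fin d → ℝ => ((2 * Real.pi) ^ (d + 1))⁻¹ * ((∏ j, Real.sinc (q j / 2) ^ 2)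
      * (2 * Real.pi * (Real.cosh (Real.sqrt ((∑ j, q j ^ 2) + m2)) - 1) / Real.sqrt ((∑ j, q j ^ 2) + m2) ^ 3
          * Real.exp (-(Real.sqrt ((∑ j, q j ^ 2) + m2) * |(1 : ℝ)|)))) :=
  (integrable_axisWeight hm (by simp)).const_mul _

/-- `W₁(q)·e^{−M_q(|t|−1)} = (2π)^{−(d+1)}·W(q)e^{−M_q|t|}` (the absorbed factor `e^{−M_q}` restored). [folklore] -/
theorem axisWeightOne_mul_exp (m2 t : ℝ) (q : Fin d → ℝ) :
    ((2 * Real.pi) ^ (d + 1))⁻¹ * ((∏ j, Real.sinc (q j / 2) ^ 2)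
      * (2 * Real.pi * (Real.cosh (Real.sqrt ((∑ j, q j ^ 2) + m2)) - 1) / Real.sqrt ((∑ j, q j ^ 2) + m2) ^ 3
          * Real.exp (-(Real.sqrt ((∑ j, q j ^ 2) + m2) * |(1 : ℝ)|))))
        * Real.exp (-(Real.sqrt ((∑ j, q j ^ 2) + m2) * (|t| - 1)))
      = ((2 * Real.pi) ^ (d + 1))⁻¹ * ((∏ j, Real.sinc (q j / 2) ^ 2)
          * (2 * Real.pi * (Real.cosh (Real.sqrt ((∑ j, q j ^ 2) + m2)) - 1) / Real.sqrt ((∑ j, q j ^ 2) + m2) ^ 3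
              * Real.exp (-(Real.sqrt ((∑ j, q j ^ 2) + m2) * |t|)))) := by
  rw [abs_one, mul_one]
  have he : Real.exp (-Real.sqrt ((∑ j, q j ^ 2) + m2)) * Real.exp (-(Real.sqrt ((∑ j, q j ^ 2) + m2) * (|t| - 1)))
      = Real.exp (-(Real.sqrt ((∑ j, q j ^ 2) + m2) * |t|)) := by
    rw [← Real.exp_add]
    congr 1
    ring
  rw [← he]
  ring

/-- ★★★ **THE SPECTRAL REPRESENTATION ON THE AXES WITH MASS GAP `m`**: for `m² > 0` and every direction `ν` there is a FINITE positive Borel measure `ρ` on `ℝ`,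
carried by `[√m², ∞)` (`ρ((−∞,√m²)) = 0`), with `S₂^{ℝ}(te_ν) = ∫e^{−λ(|t|−1)}dρ(λ)` for every integer `|t| ≥ 1`, and total mass `ρ(ℝ) = S₂^{ℝ}(e_ν)`
(`ρ` = push-forward of `(2π)^{−(d+1)}W(q)e^{−M_q}dq` under the mass shell `q ↦ M_q = √(|q|²+m²) ≥ m`). [cite: King1986, (4.5) p.670, (4.36) p.674, Thm 3.3 (3.6) p.655,
Thm 2.1 (2.22)–(2.23) p.654] -/
theorem kingS2Inf_axis_spectral_representation {m2 : ℝ} (hm : 0 < m2) (ν : Fin (d + 1)) :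
    ∃ ρ : Measure ℝ, IsFiniteMeasure ρ ∧ ρ (Iio (Real.sqrt m2)) = 0
      ∧ (∀ t : ℤ, 1 ≤ |(t : ℝ)| → kingS2Inf m2 (Pi.single ν t) = ∫ l, Real.exp (-(l * (|(t : ℝ)| - 1))) ∂ρ)
      ∧ (ρ univ).toReal = kingS2Inf m2 (Pi.single ν 1) := by
  -- the density, the mass shell, the measure
  set W1 : (Fin d → ℝ) → ℝ := fun q => ((2 * Real.pi) ^ (d + 1))⁻¹ * ((∏ j, Real.sinc (q j / 2) ^ 2)
      * (2 * Real.pi * (Real.cosh (Real.sqrt ((∑ j, q j ^ 2) + m2)) - 1) / Real.sqrt ((∑ j, q j ^ 2) + m2) ^ 3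
          * Real.exp (-(Real.sqrt ((∑ j, q j ^ 2) + m2) * |(1 : ℝ)|)))) with hW1
  set Mf : (Fin d → ℝ) → ℝ := fun q => Real.sqrt ((∑ j, q j ^ 2) + m2) with hMf
  have hW1c : Continuous W1 := continuous_axisWeightOne hm
  have hW1m : Measurable fun q => ENNReal.ofReal (W1 q) := ENNReal.measurable_ofReal.comp hW1c.measurable
  have hW1i : Integrable W1 := integrable_axisWeightOne hm
  have hMf : Measurable Mf := measurable_massShell m2
  set μ : Measure (Fin d → ℝ) := volume.withDensity fun q => ENNReal.ofReal (W1 q) with hμ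
  haveI hfin : IsFiniteMeasure μ := isFiniteMeasure_withDensity_ofReal hW1i.2
  -- integration against `μ.map Mf`
  have hint : ∀ g : ℝ → ℝ, Continuous g → ∫ l, g l ∂(μ.map Mf) = ∫ q, W1 q * g (Mf q) := by
    intro g hg
    rw [integral_map hMf.aemeasurable hg.aestronglyMeasurable, hμ,
      integral_withDensity_eq_integral_toReal_smul hW1m (Eventually.of_forall fun q => ENNReal.ofReal_lt_top)]
    refine integral_congr_ae (Eventually.of_forall fun q => ?_)
    show (ENNReal.ofReal (W1 q)).toReal • g (Mf q) = W1 q * g (Mf q)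
    rw [ENNReal.toReal_ofReal (axisWeightOne_nonneg m2 q), smul_eq_mul]
  refine ⟨μ.map Mf, inferInstance, ?_, ?_, ?_⟩
  · -- carried by `[m, ∞)`
    rw [Measure.map_apply hMf measurableSet_Iio]
    have hempty : Mf ⁻¹' Iio (Real.sqrt m2) = ∅ := by
      ext q
      simp only [mem_preimage, mem_Iio, mem_empty_iff_false, iff_false, not_lt]
      exact sqrt_le_massShell m2 q
    rw [hempty, measure_empty]
  · -- the representation
    intro t ht
    rw [hint _ (by fun_prop), kingS2Inf_single_eq hm ν ht, ← integral_const_mul]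
    refine integral_congr_ae (Eventually.of_forall fun q => ?_)
    exact (axisWeightOne_mul_exp m2 (t : ℝ) q).symm
  · -- total mass
    have h1 : 1 ≤ |((1 : ℤ) : ℝ)| := by simp
    have h := hint (fun _ => (1 : ℝ)) continuous_const
    simp only [mul_one, integral_const, smul_eq_mul, measureReal_def] at h
    rw [h, kingS2Inf_single_eq hm ν h1, ← integral_const_mul]
    refine integral_congr_ae (Eventually.of_forall fun q => ?_)
    simp only [hW1, Int.cast_one]

end Summit.QuantumFields.YangMills.BalabanUVNodes.N15KingModelRung.OptimalDecay
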